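/-
Copyright (c) 2026 the pub-hodgecm-mathlib formalisation cell (harness21).  Prover seat hodgecm-mathlib-R90-C10-p01 (g4), R90-TF SLAB section S1 «Ch10-local» (base
R90-C10), h413 = `stmt-HodgeConjecture-24833`; U4 :182 wild socket (S-W), cells (S-W-Ra)∕(S-W-Rb) of K2E3's ED. 13 split; card (W-8) «consumer assembly» (S1 dealer
R90-C10-plan (g3) 03:47:38Z, R90-C10-plan (g4) R-S1-44 (1), 2026-09-05; census `R90/R90-C10-p01/g4/CENSUS-W8.v1.md` §4): «THE WILD END ASSEMBLY FROM THE TYPE LETTERS AND THE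
PAIR ENTRIES» — PLACE-FREE, hypothesis-first: the exact letter telescope the wild producers ((W-12) type side, (W-10) entries ∘ P-wild-1 shells) must meet.  2026-09-05.
-/
import Summits.HodgeConjecture.HodgeConjecture.Theorems.R90S1BranchBDeterminantVanishingCells   -- ★ (B-0) p862976: `det_intertwiningIntegral_eq_zero_of_typeVector_of_cells` (generic `G ⊇ H, B, θ, g₀, R`)
import Summits.HodgeConjecture.HodgeConjecture.Theorems.R90S1WildDeterminantClosedForm          -- ★ (W-8)(d) p865328 (this seat): `det_ne_zero_of_bigCell_zero_wild`, `exists_root_of_det_eq_zero_wild`, `exists_eta_of_det_eq_zero_of_pairEntries_wild`; brings ★ (7), ★ (W-2′)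
import Summits.HodgeConjecture.HodgeConjecture.Theorems.R90S1BranchBConstantsRamified           -- ★ p05 (g0): `norm_apply_norm_uniformizer_lt_one` (`|χ₁(σΠ·Π)| < 1` from `hcontr`; place-free)
import Summits.HodgeConjecture.HodgeConjecture.Theorems.R90S1BposBranchBTypeBasisTwoDepthCM      -- ★ (B-1′) p863439: the `(J_e, θ)`-type basis producer (place-generic); brings the carrier vocabulary (`Gqs`, `cmBorelTriple`, `rootDeltaChar`, `locallyCompactSpace_cmBorelU`)
import HarnessLib

/-!
# R90-TF · S1 (Rogawski 1990 Ch. 12, local) — (W-8) `R90S1WildPairEntriesEndAssembly`: the WILD end assembly «type letters + pair entries ⟹ root ∕ η ∕ ⊥», PLACE-FREE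

Cell hodgecm-mathlib, slab R90-TF (director brief v2), section S1 «Ch10-local» (base R90-C10), crux h413 = stmt-HodgeConjecture-24833 (lane `--supports … --as helper`),
route `route-HodgeConjecture-HCCMUnconditional` (no route verbs).  U4 :182 wild socket (S-W), cells (S-W-Ra) ∕ (S-W-Rb); card (W-8) «consumer assembly» of the S1 dealers
R90-C10-plan (g3) (03:47:38Z) ∕ (g4) (R-S1-44 (1)) on this seat's census `CENSUS-W8.v1.md` §4.  THEOREMS ONLY (no `def`, no `instance`, no notation, no named fact, no
`sorry`); ★-only imports.

THE POINT.  ★ (8) `…RamifiedTameLeaf.exists_eta_of_reducible_twoDepth_of_pairEntries_ram` is the TAME end assembly: it INSTANTIATES the type vector (★ (B-1a) with the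
integral trace-one `t := 2⁻¹`), the cell cover (★ (B-2b″) at F-slot `k = 0`) and the ramified witnesses (★ (B-10)(2), `|2|_w = 1`), then runs ★ (B-0) «type vector + cells ⟹
det M = 0» and ★ (7) «det M = 0 ⟹ X = q⁻¹ ⟹ η».  At a WILD place the three instantiated inputs are exactly the missing bricks (census (W-8) §4 (c): type vector with the
MINIMAL trace-one `t_min`, `|t_min| = e^{d−1}` (★ (W-0), ★ bridge p865207); cover ∕ witnesses at Roche's wild datum `e_W = (⌈n∕2⌉, d−1; ⌊n∕2⌋, d)`, F-slot `k = 2(d−1)`) — so THIS FILE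
runs the SAME two ★ steps with those three inputs as LETTERS, in ★ (B-0)'s own binder shapes, and with the five entry letters in ★ p865328's two-exponent shape:
  `hT`     — the TYPE VECTOR letter: `∃ f`, `(J_e, θ)`-eigen, `f(1) ≠ 0`, `Λ_1 f = Λ_{w₀} f = 0` (★ (B-1a)'s conclusion shape; the wild producer consumes `hred` itself);
  `hwit`, `hcells` — the WITNESS ∕ COVER letters over an abstract irrelevant-cell set `R` (★ (B-0) :120–:121 VERBATIM);
  `hw1v h1wv` — the two SMALL-CELL entries `(q^{e₁})⁻¹V₁`, `(q^{e₂})⁻¹V₂` (★ Literature `HeisenbergWildFibreHaar` §3 ∕ (W-1R) box masses);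
  `h11v hwwv hΓ` ∕ `h11z hwwz` — the two BIG-CELL entries: (R-b) `V_iΓ_iX∕(1−X)` with `Γ₁Γ₂X = (q−1)²(q^{e₁+e₂+1})⁻¹` ((W-10) `HEwild` ∘ P-wild-1's `hShellW`), or (R-a) both `0`.
NO place token (`he`, `|2|_w`, `d`) appears: the assembly is PLACE-FREE; every wild fact lives in the producers of the letters.
* §1 `det_eq_zero_of_typeLetters` — ★ (B-0) at the CM carrier: type basis + `hT` + `hwit` + `hcells` ⟹ `Λ_1 f₁·Λ_{w₀} f_w − Λ_1 f_w·Λ_{w₀} f₁ = 0`.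
* §2 **`false_of_typeLetters_of_bigCell_zero`** — the (S-W-Ra) CORE: + small cells + both big cells `0` ⟹ `False` (★ p865328 `det_ne_zero_of_bigCell_zero_wild`).
* §3 **`exists_root_of_typeLetters_of_pairEntries`** — the (S-W-Rb) CORE in ★ (W-5)'s `HWRb` currency: + the five (R-b) letters ⟹ `∃ piU, |piU_{w′}| = e^{−1} ∧ χ₁(σ piU·piU) =
  halfModulusChar(σ piU·piU)` (★ p865328 `exists_root_of_det_eq_zero_wild`, `|X| < 1` by ★ `norm_apply_norm_uniformizer_lt_one`); **`exists_eta_of_typeLetters_of_pairEntries`** —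
  + `h₁ hB hFε` ⟹ `∃ η, IsQuadraticCharExtension σ η ∧ Continuous η ∧ χ₁ = η·‖·‖^{1∕2}` (★ p865328 ∘ ★ (W-2′) §4); `exists_eta_of_typeLetters_of_bigCells` — the tame-style
  DISJUNCTION «(R-a) zeros ∨ ((R-b) `hFε` ∧ Γ-shapes)» ⟹ `∃ η` (the (R-a) branch by `absurd`), i.e. ★ (8) §1's last eleven lines with the wild letters.
CONSUMERS: the (S-W-Ra)∕(S-W-Rb) payers = these cores fed by (W-12)'s type-side files (`hT hwit hcells` at `e_W`), ★ (B-1′) (`f₁ f_w`), (W-1R)∕Literature FILE 2 (volumes),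
(W-10) ∘ P-wild-1 (big cells) — each meeting a binder here by `exact`.

HONEST LABEL.  HC_CM is proved only modulo the 7 printed citations (2 remaining named inputs: hLiu418 = stmt-HodgeConjecture-24832, h413 = stmt-HodgeConjecture-24833) until
rung 0 closes; count-neutral INFRASTRUCTURE — a head MODULO LETTERS; pays NO socket; the letters' producers at a wild place are OPEN ((W-12) M–L, (W-10) S, P-wild-1 M);
(S-W-Ra)∕(S-W-Rb) OPEN, (S-W-A) XL; :182 ∕ C :88∕:98 ∕ A2′ OPEN; REL ≠ ★ ≠ BUILT.

## References
* [Keys1984] D. Keys, *Principal series representations of special unitary groups over local fields*, Compositio Math. 51 (1984), §3, §7 Theorem (2) (b)–(d) p. 126.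
* [Casselman1980] W. Casselman, *The unramified principal series of p-adic groups I*, Compositio Math. 40 (1980), §3.
* [Roche1998] A. Roche, *Types and Hecke algebras for principal series representations of split reductive p-adic groups*, Ann. Sci. ÉNS (4) 31 (1998), §3–§4.
* [Rogawski1990] J. D. Rogawski, *Automorphic Representations of Unitary Groups in Three Variables*, Ann. of Math. Stud. 123 (1990), §12.2 (1)–(2) p. 173.
* [Tits1979] J. Tits, *Reductive groups over local fields*, Proc. Sympos. Pure Math. 33 Part 1 (1979), §1.15 (wild quasi-split `SU₃`).
-/

set_option autoImplicit false
-- the mandated namespace has the single-problem summit's repeated segment (`HodgeConjecture.HodgeConjecture`)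
set_option linter.dupNamespace false

noncomputable section

open NumberField IsDedekindDomain MeasureTheory
open scoped Matrix MatrixGroups WithZero Valued NNReal
open Literature.NumberTheory Literature.NumberTheory.Automorphic Literature.NumberTheory.Automorphic.UnitaryGroup
open Literature.NumberTheory.Rogawski1990

namespace Summit.HodgeConjecture.HodgeConjecture.R90.S1.WildPairEntriesEndAssembly

open Summit.HodgeConjecture.HodgeConjecture.Cruxes.H413
open Summit.HodgeConjecture.HodgeConjecture.R90.S1
open Classical

variable (L : Type) [Field L] [NumberField L] [IsCMField L] (v : HeightOneSpectrum (𝓞 ↥(maximalRealSubfield L)))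

/-! ## §1 ★ (B-0) at the CM carrier: type basis + type vector + cells ⟹ `det M = 0` -/

set_option synthInstance.maxHeartbeats 400000 in
set_option maxHeartbeats 1600000 in
-- the `SmoothInd` carrier on `U(Φ₃)(L⁺_v)` (class of ★ (8) §1 ∕ ★ (B-1′)): ★ (B-0)'s generic binders met by `exact`
/-- **`det M = 0` FROM THE TYPE LETTERS, PLACE-FREE.**  On `G = U(Φ₃)(L⁺_v)` with `P = (cmBorelTriple L 3 v).P`, the character `χ₁ ⊗ 1` of the torus inflated to `P` and
twisted by `δ_P^{1∕2}`, a level group `Je ≤ G` with its multiplier `θ(x) = χ₁(x₀₀)`, an element `w₀`, a measure `μ` on `N`: IF `(f₁, f_w)` is a normalised `(Je, θ)`-type basis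
of `i(χ₁, 1)` with integrable cell integrals (letters of ★ (B-1′)), the irrelevant cells `R` are witnessed and cover (`hwit`, `hcells` — ★ (B-0)'s shapes), and a TYPE VECTOR
killed by `Λ_1`, `Λ_{w₀}` with `f(1) ≠ 0` exists (`hT` — ★ (B-1a)'s conclusion shape; its wild producer consumes `hred`), THEN
`Λ_1 f₁·Λ_{w₀} f_w − Λ_1 f_w·Λ_{w₀} f₁ = 0`.  One call of ★ (B-0). [cite: Casselman1980, §3] [cite: Roche1998, §3–§4] [cite: Keys1984, §7 Theorem (2) (d) p. 126] -/
theorem det_eq_zero_of_typeLetters (χ₁ : (LocalRing L v)ˣ →* ℂˣ)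
    (Je : Subgroup ↥(unitaryGroupOfForm (conjLocal L (IsCMField.complexConj L) v) (cmLocalForm L 3 v))) (w₀ : ↥(unitaryGroupOfForm (conjLocal L (IsCMField.complexConj L) v) (cmLocalForm L 3 v)))
    [MeasurableSpace ↥(cmBorelTriple L 3 v).N] (μ : Measure ↥(cmBorelTriple L 3 v).N)
    (f₁ f_w : haveI := locallyCompactSpace_cmBorelU L 3 v
      Representation.SmoothInd (cmBorelTriple L 3 v).P
        (Representation.twist (((Representation.trivial ℂ ↥(torusU (conjLocal L (IsCMField.complexConj L) v) (cmLocalForm L 3 v)) ℂ).twist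
          (cmTorusCharPair L v χ₁ 1)).comp (cmBorelTriple L 3 v).proj) (rootDeltaChar (cmBorelTriple L 3 v).P)))
    (heig₁ : ∀ x ∈ Je, (haveI := locallyCompactSpace_cmBorelU L 3 v; Representation.smoothIndRep _ _ x f₁) =
      (if h : IsUnit (((x.val : GL (Fin 3) (LocalRing L v)) : Matrix (Fin 3) (Fin 3) (LocalRing L v)) 0 0) then ((χ₁ h.unit : ℂˣ) : ℂ) else 0) • f₁)
    (heig_w : ∀ x ∈ Je, (haveI := locallyCompactSpace_cmBorelU L 3 v; Representation.smoothIndRep _ _ x f_w) =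
      (if h : IsUnit (((x.val : GL (Fin 3) (LocalRing L v)) : Matrix (Fin 3) (Fin 3) (LocalRing L v)) 0 0) then ((χ₁ h.unit : ℂˣ) : ℂ) else 0) • f_w)
    (h11 : f₁.toFun 1 = 1) (h1g : f₁.toFun w₀ = 0) (hw1 : f_w.toFun 1 = 0) (hwg : f_w.toFun w₀ = 1)
    (hi₁₁ : Integrable (fun n : ↥(cmBorelTriple L 3 v).N => f₁.toFun (w₀ * (n : ↥(unitaryGroupOfForm (conjLocal L (IsCMField.complexConj L) v) (cmLocalForm L 3 v))) * 1)) μ)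
    (hiw₁ : Integrable (fun n : ↥(cmBorelTriple L 3 v).N => f_w.toFun (w₀ * (n : ↥(unitaryGroupOfForm (conjLocal L (IsCMField.complexConj L) v) (cmLocalForm L 3 v))) * 1)) μ)
    (hi₁₂ : Integrable (fun n : ↥(cmBorelTriple L 3 v).N => f₁.toFun (w₀ * (n : ↥(unitaryGroupOfForm (conjLocal L (IsCMField.complexConj L) v) (cmLocalForm L 3 v))) * w₀)) μ)
    (hiw₂ : Integrable (fun n : ↥(cmBorelTriple L 3 v).N => f_w.toFun (w₀ * (n : ↥(unitaryGroupOfForm (conjLocal L (IsCMField.complexConj L) v) (cmLocalForm L 3 v))) * w₀)) μ)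
    -- the cell letters (★ (B-0) :120–:121's shapes)
    (R : Set ↥(unitaryGroupOfForm (conjLocal L (IsCMField.complexConj L) v) (cmLocalForm L 3 v)))
    (hwit : ∀ r ∈ R, ∃ b₀ ∈ Je, ∃ hb₀H : r * b₀ * r⁻¹ ∈ (cmBorelTriple L 3 v).P,
      (if h : IsUnit (((b₀.val : GL (Fin 3) (LocalRing L v)) : Matrix (Fin 3) (Fin 3) (LocalRing L v)) 0 0) then ((χ₁ h.unit : ℂˣ) : ℂ) else 0) ≠
        (haveI := locallyCompactSpace_cmBorelU L 3 v
         (Representation.twist (((Representation.trivial ℂ ↥(torusU (conjLocal L (IsCMField.complexConj L) v) (cmLocalForm L 3 v)) ℂ).twist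
          (cmTorusCharPair L v χ₁ 1)).comp (cmBorelTriple L 3 v).proj) (rootDeltaChar (cmBorelTriple L 3 v).P)) ⟨r * b₀ * r⁻¹, hb₀H⟩ 1))
    (hcells : ∀ y : ↥(unitaryGroupOfForm (conjLocal L (IsCMField.complexConj L) v) (cmLocalForm L 3 v)), (∃ h ∈ (cmBorelTriple L 3 v).P, ∃ b ∈ Je, y = h * b) ∨ (∃ h ∈ (cmBorelTriple L 3 v).P, ∃ b ∈ Je, y = h * w₀ * b) ∨
      ∃ r ∈ R, ∃ h ∈ (cmBorelTriple L 3 v).P, ∃ b ∈ Je, y = h * r * b)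
    -- the type-vector letter (★ (B-1a)'s conclusion shape)
    (hT : ∃ f : (haveI := locallyCompactSpace_cmBorelU L 3 v
        Representation.SmoothInd (cmBorelTriple L 3 v).P
          (Representation.twist (((Representation.trivial ℂ ↥(torusU (conjLocal L (IsCMField.complexConj L) v) (cmLocalForm L 3 v)) ℂ).twist
            (cmTorusCharPair L v χ₁ 1)).comp (cmBorelTriple L 3 v).proj) (rootDeltaChar (cmBorelTriple L 3 v).P))),
      (∀ x ∈ Je, (haveI := locallyCompactSpace_cmBorelU L 3 v; Representation.smoothIndRep _ _ x f) =
        (if h : IsUnit (((x.val : GL (Fin 3) (LocalRing L v)) : Matrix (Fin 3) (Fin 3) (LocalRing L v)) 0 0) then ((χ₁ h.unit : ℂˣ) : ℂ) else 0) • f) ∧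
      f.toFun 1 ≠ 0 ∧
      ∫ n : ↥(cmBorelTriple L 3 v).N, f.toFun (w₀ * (n : ↥(unitaryGroupOfForm (conjLocal L (IsCMField.complexConj L) v) (cmLocalForm L 3 v))) * 1) ∂μ = 0 ∧
      ∫ n : ↥(cmBorelTriple L 3 v).N, f.toFun (w₀ * (n : ↥(unitaryGroupOfForm (conjLocal L (IsCMField.complexConj L) v) (cmLocalForm L 3 v))) * w₀) ∂μ = 0) :
    (∫ n : ↥(cmBorelTriple L 3 v).N, f₁.toFun (w₀ * (n : ↥(unitaryGroupOfForm (conjLocal L (IsCMField.complexConj L) v) (cmLocalForm L 3 v))) * 1) ∂μ) *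
        (∫ n : ↥(cmBorelTriple L 3 v).N, f_w.toFun (w₀ * (n : ↥(unitaryGroupOfForm (conjLocal L (IsCMField.complexConj L) v) (cmLocalForm L 3 v))) * w₀) ∂μ) -
      (∫ n : ↥(cmBorelTriple L 3 v).N, f_w.toFun (w₀ * (n : ↥(unitaryGroupOfForm (conjLocal L (IsCMField.complexConj L) v) (cmLocalForm L 3 v))) * 1) ∂μ) *
        (∫ n : ↥(cmBorelTriple L 3 v).N, f₁.toFun (w₀ * (n : ↥(unitaryGroupOfForm (conjLocal L (IsCMField.complexConj L) v) (cmLocalForm L 3 v))) * w₀) ∂μ) = 0 := by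
  haveI := locallyCompactSpace_cmBorelU L 3 v
  obtain ⟨f, heig, hf1, hΛ1, hΛw⟩ := hT
  exact BranchBDeterminantVanishingCells.det_intertwiningIntegral_eq_zero_of_typeVector_of_cells (cmBorelTriple L 3 v).P
    (Representation.twist (((Representation.trivial ℂ ↥(torusU (conjLocal L (IsCMField.complexConj L) v) (cmLocalForm L 3 v)) ℂ).twist
      (cmTorusCharPair L v χ₁ 1)).comp (cmBorelTriple L 3 v).proj) (rootDeltaChar (cmBorelTriple L 3 v).P))
    Je (fun g : ↥(unitaryGroupOfForm (conjLocal L (IsCMField.complexConj L) v) (cmLocalForm L 3 v)) => if h : IsUnit (((g.val : GL (Fin 3) (LocalRing L v)) : Matrix (Fin 3) (Fin 3) (LocalRing L v)) 0 0) then ((χ₁ h.unit : ℂˣ) : ℂ) else 0)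
    w₀ R hwit hcells (cmBorelTriple L 3 v).N μ w₀ 1 w₀ f₁ f_w heig₁ heig_w h11 h1g hw1 hwg hi₁₁ hiw₁ hi₁₂ hiw₂ f heig hf1 hΛ1 hΛw

/-! ## §2 The (S-W-Ra) core: both big cells `0` ⟹ `False` -/

set_option synthInstance.maxHeartbeats 400000 in
set_option maxHeartbeats 1600000 in
-- as §1
/-- **(S-W-Ra) CORE, PLACE-FREE: type letters + the two volumes + BOTH BIG CELLS `0` ⟹ `False`.**  With §1's letters, the small cells `Λ_1 f_w = (q^{e₁})⁻¹V₂`,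
`Λ_{w₀} f₁ = (q^{e₂})⁻¹V₁` (`V₁, V₂ ≠ 0`, `q = N𝔓_w`) and `Λ_1 f₁ = Λ_{w₀} f_w = 0` ((R-a): every cut shell vanishes): ★ (B-0) gives `det M = 0` while ★ p865328
`det_ne_zero_of_bigCell_zero_wild` gives `det M ≠ 0`.  The wild (R-a) payer feeds `hT` from `hred` and concludes `absurd`. [cite: Keys1984, §7 Theorem (2) (d) p. 126] [cite: Casselman1980, §3] -/
theorem false_of_typeLetters_of_bigCell_zero (w : PlacesOver L v) (χ₁ : (LocalRing L v)ˣ →* ℂˣ)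
    (Je : Subgroup ↥(unitaryGroupOfForm (conjLocal L (IsCMField.complexConj L) v) (cmLocalForm L 3 v))) (w₀ : ↥(unitaryGroupOfForm (conjLocal L (IsCMField.complexConj L) v) (cmLocalForm L 3 v)))
    [MeasurableSpace ↥(cmBorelTriple L 3 v).N] (μ : Measure ↥(cmBorelTriple L 3 v).N)
    (f₁ f_w : haveI := locallyCompactSpace_cmBorelU L 3 v
      Representation.SmoothInd (cmBorelTriple L 3 v).P
        (Representation.twist (((Representation.trivial ℂ ↥(torusU (conjLocal L (IsCMField.complexConj L) v) (cmLocalForm L 3 v)) ℂ).twist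
          (cmTorusCharPair L v χ₁ 1)).comp (cmBorelTriple L 3 v).proj) (rootDeltaChar (cmBorelTriple L 3 v).P)))
    (heig₁ : ∀ x ∈ Je, (haveI := locallyCompactSpace_cmBorelU L 3 v; Representation.smoothIndRep _ _ x f₁) =
      (if h : IsUnit (((x.val : GL (Fin 3) (LocalRing L v)) : Matrix (Fin 3) (Fin 3) (LocalRing L v)) 0 0) then ((χ₁ h.unit : ℂˣ) : ℂ) else 0) • f₁)
    (heig_w : ∀ x ∈ Je, (haveI := locallyCompactSpace_cmBorelU L 3 v; Representation.smoothIndRep _ _ x f_w) =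
      (if h : IsUnit (((x.val : GL (Fin 3) (LocalRing L v)) : Matrix (Fin 3) (Fin 3) (LocalRing L v)) 0 0) then ((χ₁ h.unit : ℂˣ) : ℂ) else 0) • f_w)
    (h11 : f₁.toFun 1 = 1) (h1g : f₁.toFun w₀ = 0) (hw1 : f_w.toFun 1 = 0) (hwg : f_w.toFun w₀ = 1)
    (hi₁₁ : Integrable (fun n : ↥(cmBorelTriple L 3 v).N => f₁.toFun (w₀ * (n : ↥(unitaryGroupOfForm (conjLocal L (IsCMField.complexConj L) v) (cmLocalForm L 3 v))) * 1)) μ)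
    (hiw₁ : Integrable (fun n : ↥(cmBorelTriple L 3 v).N => f_w.toFun (w₀ * (n : ↥(unitaryGroupOfForm (conjLocal L (IsCMField.complexConj L) v) (cmLocalForm L 3 v))) * 1)) μ)
    (hi₁₂ : Integrable (fun n : ↥(cmBorelTriple L 3 v).N => f₁.toFun (w₀ * (n : ↥(unitaryGroupOfForm (conjLocal L (IsCMField.complexConj L) v) (cmLocalForm L 3 v))) * w₀)) μ)
    (hiw₂ : Integrable (fun n : ↥(cmBorelTriple L 3 v).N => f_w.toFun (w₀ * (n : ↥(unitaryGroupOfForm (conjLocal L (IsCMField.complexConj L) v) (cmLocalForm L 3 v))) * w₀)) μ)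
    (R : Set ↥(unitaryGroupOfForm (conjLocal L (IsCMField.complexConj L) v) (cmLocalForm L 3 v)))
    (hwit : ∀ r ∈ R, ∃ b₀ ∈ Je, ∃ hb₀H : r * b₀ * r⁻¹ ∈ (cmBorelTriple L 3 v).P,
      (if h : IsUnit (((b₀.val : GL (Fin 3) (LocalRing L v)) : Matrix (Fin 3) (Fin 3) (LocalRing L v)) 0 0) then ((χ₁ h.unit : ℂˣ) : ℂ) else 0) ≠
        (haveI := locallyCompactSpace_cmBorelU L 3 v
         (Representation.twist (((Representation.trivial ℂ ↥(torusU (conjLocal L (IsCMField.complexConj L) v) (cmLocalForm L 3 v)) ℂ).twist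
          (cmTorusCharPair L v χ₁ 1)).comp (cmBorelTriple L 3 v).proj) (rootDeltaChar (cmBorelTriple L 3 v).P)) ⟨r * b₀ * r⁻¹, hb₀H⟩ 1))
    (hcells : ∀ y : ↥(unitaryGroupOfForm (conjLocal L (IsCMField.complexConj L) v) (cmLocalForm L 3 v)), (∃ h ∈ (cmBorelTriple L 3 v).P, ∃ b ∈ Je, y = h * b) ∨ (∃ h ∈ (cmBorelTriple L 3 v).P, ∃ b ∈ Je, y = h * w₀ * b) ∨
      ∃ r ∈ R, ∃ h ∈ (cmBorelTriple L 3 v).P, ∃ b ∈ Je, y = h * r * b)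
    (hT : ∃ f : (haveI := locallyCompactSpace_cmBorelU L 3 v
        Representation.SmoothInd (cmBorelTriple L 3 v).P
          (Representation.twist (((Representation.trivial ℂ ↥(torusU (conjLocal L (IsCMField.complexConj L) v) (cmLocalForm L 3 v)) ℂ).twist
            (cmTorusCharPair L v χ₁ 1)).comp (cmBorelTriple L 3 v).proj) (rootDeltaChar (cmBorelTriple L 3 v).P))),
      (∀ x ∈ Je, (haveI := locallyCompactSpace_cmBorelU L 3 v; Representation.smoothIndRep _ _ x f) =
        (if h : IsUnit (((x.val : GL (Fin 3) (LocalRing L v)) : Matrix (Fin 3) (Fin 3) (LocalRing L v)) 0 0) then ((χ₁ h.unit : ℂˣ) : ℂ) else 0) • f) ∧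
      f.toFun 1 ≠ 0 ∧
      ∫ n : ↥(cmBorelTriple L 3 v).N, f.toFun (w₀ * (n : ↥(unitaryGroupOfForm (conjLocal L (IsCMField.complexConj L) v) (cmLocalForm L 3 v))) * 1) ∂μ = 0 ∧
      ∫ n : ↥(cmBorelTriple L 3 v).N, f.toFun (w₀ * (n : ↥(unitaryGroupOfForm (conjLocal L (IsCMField.complexConj L) v) (cmLocalForm L 3 v))) * w₀) ∂μ = 0)
    -- the two volumes and the (R-a) zeros
    (V₁ V₂ : ℂ) (hV₁ : V₁ ≠ 0) (hV₂ : V₂ ≠ 0) (e₁ e₂ : ℕ)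
    (hw1v : ∫ n : ↥(cmBorelTriple L 3 v).N, f_w.toFun (w₀ * (n : ↥(unitaryGroupOfForm (conjLocal L (IsCMField.complexConj L) v) (cmLocalForm L 3 v))) * 1) ∂μ =
      (((Ideal.absNorm w.1.asIdeal : ℝ) : ℂ) ^ e₂)⁻¹ * V₂)
    (h1wv : ∫ n : ↥(cmBorelTriple L 3 v).N, f₁.toFun (w₀ * (n : ↥(unitaryGroupOfForm (conjLocal L (IsCMField.complexConj L) v) (cmLocalForm L 3 v))) * w₀) ∂μ =
      (((Ideal.absNorm w.1.asIdeal : ℝ) : ℂ) ^ e₁)⁻¹ * V₁)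
    (h11z : ∫ n : ↥(cmBorelTriple L 3 v).N, f₁.toFun (w₀ * (n : ↥(unitaryGroupOfForm (conjLocal L (IsCMField.complexConj L) v) (cmLocalForm L 3 v))) * 1) ∂μ = 0)
    (hwwz : ∫ n : ↥(cmBorelTriple L 3 v).N, f_w.toFun (w₀ * (n : ↥(unitaryGroupOfForm (conjLocal L (IsCMField.complexConj L) v) (cmLocalForm L 3 v))) * w₀) ∂μ = 0) :
    False := by
  have hdet := det_eq_zero_of_typeLetters L v χ₁ Je w₀ μ f₁ f_w heig₁ heig_w h11 h1g hw1 hwg hi₁₁ hiw₁ hi₁₂ hiw₂ R hwit hcells hT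
  have hq0 : ((Ideal.absNorm w.1.asIdeal : ℝ) : ℂ) ≠ 0 := by
    have h : (1 : ℝ) < (Ideal.absNorm w.1.asIdeal : ℝ) := by exact_mod_cast NumberField.HeightOneSpectrum.one_lt_absNorm w.1
    exact_mod_cast (lt_trans zero_lt_one h).ne'
  exact WildDeterminantClosedForm.det_ne_zero_of_bigCell_zero_wild ((Ideal.absNorm w.1.asIdeal : ℝ) : ℂ) V₁ V₂ _ _ _ _ e₁ e₂ hq0 hV₁ hV₂ h11z hwwz h1wv hw1v hdet

/-! ## §3 The (S-W-Rb) core: the five (R-b) letters ⟹ the root (★ (W-5)'s `HWRb` currency), and `η` -/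

section Root

variable (hns : ∀ w : PlacesOver L v, IsCMField.complexConj L • w.1 = w.1) (w : PlacesOver L v) (hw : IsCMField.complexConj L • w.1 = w.1)

include hns hw in
set_option synthInstance.maxHeartbeats 400000 in
set_option maxHeartbeats 1600000 in
-- as §1
/-- **(S-W-Rb) CORE, PLACE-FREE: type letters + the five (R-b) letters ⟹ THE ROOT `χ₁(σΠ·Π) = halfModulusChar(σΠ·Π)` at a uniformiser unit** — ★ (W-5) `HWRb`'s ∃-conclusion
shape VERBATIM.  Letters: §1's type letters; a uniformiser unit `Π` (`|Π_{w′}| = exp(−1)`); `χ₁` contracting (`hcontr`, for `|X| < 1` by ★ `norm_apply_norm_uniformizer_lt_one`);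
the two volumes `(q^{e₂})⁻¹V₂`, `(q^{e₁})⁻¹V₁` and the two Γ-shapes `V₁Γ₁X∕(1−X)`, `V₂Γ₂X∕(1−X)` with `Γ₁Γ₂X = (q−1)²(q^{e₁+e₂+1})⁻¹` (`X = χ₁(σΠ·Π)`, `q = N𝔓_w`).  Proof: §1
(`det M = 0`) + ★ p865328 `exists_root_of_det_eq_zero_wild`.  NO place token: valid at every non-split `v`; at a wild `w` the producers instantiate `e_W`, `t_min`, `d`.
[cite: Keys1984, §7 Theorem (2) (d) p. 126] [cite: Casselman1980, §3] [cite: Roche1998, §3–§4] [cite: Rogawski1990, §12.2 (2) p. 173] -/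
theorem exists_root_of_typeLetters_of_pairEntries
    (piU : (LocalRing L v)ˣ) (hpiU : ∀ w' : PlacesOver L v, Valued.v ((piU : LocalRing L v) w') = WithZero.exp (-1 : ℤ))
    (χ₁ : (LocalRing L v)ˣ →* ℂˣ) (hcontr : ∀ x : (LocalRing L v)ˣ, unitModulusChar (LocalRing L v) x < 1 → ‖((χ₁ x : ℂˣ) : ℂ)‖ < 1)
    (Je : Subgroup ↥(unitaryGroupOfForm (conjLocal L (IsCMField.complexConj L) v) (cmLocalForm L 3 v))) (w₀ : ↥(unitaryGroupOfForm (conjLocal L (IsCMField.complexConj L) v) (cmLocalForm L 3 v)))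
    [MeasurableSpace ↥(cmBorelTriple L 3 v).N] (μ : Measure ↥(cmBorelTriple L 3 v).N)
    (f₁ f_w : haveI := locallyCompactSpace_cmBorelU L 3 v
      Representation.SmoothInd (cmBorelTriple L 3 v).P
        (Representation.twist (((Representation.trivial ℂ ↥(torusU (conjLocal L (IsCMField.complexConj L) v) (cmLocalForm L 3 v)) ℂ).twist
          (cmTorusCharPair L v χ₁ 1)).comp (cmBorelTriple L 3 v).proj) (rootDeltaChar (cmBorelTriple L 3 v).P)))
    (heig₁ : ∀ x ∈ Je, (haveI := locallyCompactSpace_cmBorelU L 3 v; Representation.smoothIndRep _ _ x f₁) =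
      (if h : IsUnit (((x.val : GL (Fin 3) (LocalRing L v)) : Matrix (Fin 3) (Fin 3) (LocalRing L v)) 0 0) then ((χ₁ h.unit : ℂˣ) : ℂ) else 0) • f₁)
    (heig_w : ∀ x ∈ Je, (haveI := locallyCompactSpace_cmBorelU L 3 v; Representation.smoothIndRep _ _ x f_w) =
      (if h : IsUnit (((x.val : GL (Fin 3) (LocalRing L v)) : Matrix (Fin 3) (Fin 3) (LocalRing L v)) 0 0) then ((χ₁ h.unit : ℂˣ) : ℂ) else 0) • f_w)
    (h11 : f₁.toFun 1 = 1) (h1g : f₁.toFun w₀ = 0) (hw1 : f_w.toFun 1 = 0) (hwg : f_w.toFun w₀ = 1)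
    (hi₁₁ : Integrable (fun n : ↥(cmBorelTriple L 3 v).N => f₁.toFun (w₀ * (n : ↥(unitaryGroupOfForm (conjLocal L (IsCMField.complexConj L) v) (cmLocalForm L 3 v))) * 1)) μ)
    (hiw₁ : Integrable (fun n : ↥(cmBorelTriple L 3 v).N => f_w.toFun (w₀ * (n : ↥(unitaryGroupOfForm (conjLocal L (IsCMField.complexConj L) v) (cmLocalForm L 3 v))) * 1)) μ)
    (hi₁₂ : Integrable (fun n : ↥(cmBorelTriple L 3 v).N => f₁.toFun (w₀ * (n : ↥(unitaryGroupOfForm (conjLocal L (IsCMField.complexConj L) v) (cmLocalForm L 3 v))) * w₀)) μ)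
    (hiw₂ : Integrable (fun n : ↥(cmBorelTriple L 3 v).N => f_w.toFun (w₀ * (n : ↥(unitaryGroupOfForm (conjLocal L (IsCMField.complexConj L) v) (cmLocalForm L 3 v))) * w₀)) μ)
    (R : Set ↥(unitaryGroupOfForm (conjLocal L (IsCMField.complexConj L) v) (cmLocalForm L 3 v)))
    (hwit : ∀ r ∈ R, ∃ b₀ ∈ Je, ∃ hb₀H : r * b₀ * r⁻¹ ∈ (cmBorelTriple L 3 v).P,
      (if h : IsUnit (((b₀.val : GL (Fin 3) (LocalRing L v)) : Matrix (Fin 3) (Fin 3) (LocalRing L v)) 0 0) then ((χ₁ h.unit : ℂˣ) : ℂ) else 0) ≠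
        (haveI := locallyCompactSpace_cmBorelU L 3 v
         (Representation.twist (((Representation.trivial ℂ ↥(torusU (conjLocal L (IsCMField.complexConj L) v) (cmLocalForm L 3 v)) ℂ).twist
          (cmTorusCharPair L v χ₁ 1)).comp (cmBorelTriple L 3 v).proj) (rootDeltaChar (cmBorelTriple L 3 v).P)) ⟨r * b₀ * r⁻¹, hb₀H⟩ 1))
    (hcells : ∀ y : ↥(unitaryGroupOfForm (conjLocal L (IsCMField.complexConj L) v) (cmLocalForm L 3 v)), (∃ h ∈ (cmBorelTriple L 3 v).P, ∃ b ∈ Je, y = h * b) ∨ (∃ h ∈ (cmBorelTriple L 3 v).P, ∃ b ∈ Je, y = h * w₀ * b) ∨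
      ∃ r ∈ R, ∃ h ∈ (cmBorelTriple L 3 v).P, ∃ b ∈ Je, y = h * r * b)
    (hT : ∃ f : (haveI := locallyCompactSpace_cmBorelU L 3 v
        Representation.SmoothInd (cmBorelTriple L 3 v).P
          (Representation.twist (((Representation.trivial ℂ ↥(torusU (conjLocal L (IsCMField.complexConj L) v) (cmLocalForm L 3 v)) ℂ).twist
            (cmTorusCharPair L v χ₁ 1)).comp (cmBorelTriple L 3 v).proj) (rootDeltaChar (cmBorelTriple L 3 v).P))),
      (∀ x ∈ Je, (haveI := locallyCompactSpace_cmBorelU L 3 v; Representation.smoothIndRep _ _ x f) =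
        (if h : IsUnit (((x.val : GL (Fin 3) (LocalRing L v)) : Matrix (Fin 3) (Fin 3) (LocalRing L v)) 0 0) then ((χ₁ h.unit : ℂˣ) : ℂ) else 0) • f) ∧
      f.toFun 1 ≠ 0 ∧
      ∫ n : ↥(cmBorelTriple L 3 v).N, f.toFun (w₀ * (n : ↥(unitaryGroupOfForm (conjLocal L (IsCMField.complexConj L) v) (cmLocalForm L 3 v))) * 1) ∂μ = 0 ∧
      ∫ n : ↥(cmBorelTriple L 3 v).N, f.toFun (w₀ * (n : ↥(unitaryGroupOfForm (conjLocal L (IsCMField.complexConj L) v) (cmLocalForm L 3 v))) * w₀) ∂μ = 0)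
    -- the five (R-b) letters in ★ p865328's two-exponent shape
    (V₁ V₂ : ℂ) (hV₁ : V₁ ≠ 0) (hV₂ : V₂ ≠ 0) (e₁ e₂ : ℕ) (Γ₁ Γ₂ : ℂ)
    (hw1v : ∫ n : ↥(cmBorelTriple L 3 v).N, f_w.toFun (w₀ * (n : ↥(unitaryGroupOfForm (conjLocal L (IsCMField.complexConj L) v) (cmLocalForm L 3 v))) * 1) ∂μ =
      (((Ideal.absNorm w.1.asIdeal : ℝ) : ℂ) ^ e₂)⁻¹ * V₂)
    (h1wv : ∫ n : ↥(cmBorelTriple L 3 v).N, f₁.toFun (w₀ * (n : ↥(unitaryGroupOfForm (conjLocal L (IsCMField.complexConj L) v) (cmLocalForm L 3 v))) * w₀) ∂μ =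
      (((Ideal.absNorm w.1.asIdeal : ℝ) : ℂ) ^ e₁)⁻¹ * V₁)
    (hΓ : Γ₁ * Γ₂ * ((χ₁ (Units.map (conjLocal L (IsCMField.complexConj L) v : LocalRing L v →* LocalRing L v) piU * piU) : ℂˣ) : ℂ) =
      (((Ideal.absNorm w.1.asIdeal : ℝ) : ℂ) - 1) ^ 2 * ((((Ideal.absNorm w.1.asIdeal : ℝ) : ℂ)) ^ (e₁ + e₂ + 1))⁻¹)
    (h11v : ∫ n : ↥(cmBorelTriple L 3 v).N, f₁.toFun (w₀ * (n : ↥(unitaryGroupOfForm (conjLocal L (IsCMField.complexConj L) v) (cmLocalForm L 3 v))) * 1) ∂μ =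
      V₁ * (Γ₁ * ((χ₁ (Units.map (conjLocal L (IsCMField.complexConj L) v : LocalRing L v →* LocalRing L v) piU * piU) : ℂˣ) : ℂ) /
        (1 - ((χ₁ (Units.map (conjLocal L (IsCMField.complexConj L) v : LocalRing L v →* LocalRing L v) piU * piU) : ℂˣ) : ℂ))))
    (hwwv : ∫ n : ↥(cmBorelTriple L 3 v).N, f_w.toFun (w₀ * (n : ↥(unitaryGroupOfForm (conjLocal L (IsCMField.complexConj L) v) (cmLocalForm L 3 v))) * w₀) ∂μ =
      V₂ * (Γ₂ * ((χ₁ (Units.map (conjLocal L (IsCMField.complexConj L) v : LocalRing L v →* LocalRing L v) piU * piU) : ℂˣ) : ℂ) /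
        (1 - ((χ₁ (Units.map (conjLocal L (IsCMField.complexConj L) v : LocalRing L v →* LocalRing L v) piU * piU) : ℂˣ) : ℂ)))) :
    ∃ piU' : (LocalRing L v)ˣ, (∀ w' : PlacesOver L v, Valued.v ((piU' : LocalRing L v) w') = WithZero.exp (-1 : ℤ)) ∧
      χ₁ (Units.map (conjLocal L (IsCMField.complexConj L) v : LocalRing L v →* LocalRing L v) piU' * piU') =
        halfModulusChar (LocalRing L v) (Units.map (conjLocal L (IsCMField.complexConj L) v : LocalRing L v →* LocalRing L v) piU' * piU') := by
  have hdet := det_eq_zero_of_typeLetters L v χ₁ Je w₀ μ f₁ f_w heig₁ heig_w h11 h1g hw1 hwg hi₁₁ hiw₁ hi₁₂ hiw₂ R hwit hcells hT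
  have hX := norm_apply_norm_uniformizer_lt_one L v hns w hw piU hpiU χ₁ hcontr
  exact WildDeterminantClosedForm.exists_root_of_det_eq_zero_wild L v hns w hw piU hpiU χ₁ e₁ e₂ Γ₁ Γ₂ V₁ V₂ _ _ _ _ hV₁ hV₂ hX h11v hwwv h1wv hw1v hΓ hdet

include hns hw in
set_option synthInstance.maxHeartbeats 400000 in
set_option maxHeartbeats 1600000 in
-- as §1
/-- **(S-W-Rb), `η` FORM, PLACE-FREE: type letters + the five (R-b) letters + `h₁ hB hFε` ⟹ `χ₁ = η·‖·‖^{1∕2}`** (`∃ η, IsQuadraticCharExtension σ η ∧ Continuous η ∧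
χ₁ = η·halfModulusChar`): §3's root + ★ (W-2′) §4 (through ★ p865328 `exists_eta_of_det_eq_zero_of_pairEntries_wild`).  The wild twin of ★ (8) §1's (R-b) branch.
[cite: Keys1984, §7 Theorem (2) (d) p. 126] [cite: Casselman1980, §3] [cite: Rogawski1990, §12.2 (2) p. 173; §4.8 p. 51] [cite: Serre1979, Ch. V §3 Prop. 5 Cor. 3] -/
theorem exists_eta_of_typeLetters_of_pairEntries
    (piU : (LocalRing L v)ˣ) (hpiU : ∀ w' : PlacesOver L v, Valued.v ((piU : LocalRing L v) w') = WithZero.exp (-1 : ℤ))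
    (χ₁ : (LocalRing L v)ˣ →* ℂˣ) (h₁ : Continuous (fun x => ((χ₁ x : ℂˣ) : ℂ)))
    (hcontr : ∀ x : (LocalRing L v)ˣ, unitModulusChar (LocalRing L v) x < 1 → ‖((χ₁ x : ℂˣ) : ℂ)‖ < 1)
    (hB : ∀ u : (LocalRing L v)ˣ, (∀ w' : PlacesOver L v, Valued.v ((u : LocalRing L v) w') = 1) →
      χ₁ (u * Units.map (conjLocal L (IsCMField.complexConj L) v : LocalRing L v →* LocalRing L v) u) = 1)
    (hFε : ∃ a : (LocalRing L v)ˣ, Units.map (conjLocal L (IsCMField.complexConj L) v : LocalRing L v →* LocalRing L v) a = a ∧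
      (∀ w' : PlacesOver L v, Valued.v ((a : LocalRing L v) w') = 1) ∧ χ₁ a ≠ 1)
    (Je : Subgroup ↥(unitaryGroupOfForm (conjLocal L (IsCMField.complexConj L) v) (cmLocalForm L 3 v))) (w₀ : ↥(unitaryGroupOfForm (conjLocal L (IsCMField.complexConj L) v) (cmLocalForm L 3 v)))
    [MeasurableSpace ↥(cmBorelTriple L 3 v).N] (μ : Measure ↥(cmBorelTriple L 3 v).N)
    (f₁ f_w : haveI := locallyCompactSpace_cmBorelU L 3 v
      Representation.SmoothInd (cmBorelTriple L 3 v).P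
        (Representation.twist (((Representation.trivial ℂ ↥(torusU (conjLocal L (IsCMField.complexConj L) v) (cmLocalForm L 3 v)) ℂ).twist
          (cmTorusCharPair L v χ₁ 1)).comp (cmBorelTriple L 3 v).proj) (rootDeltaChar (cmBorelTriple L 3 v).P)))
    (heig₁ : ∀ x ∈ Je, (haveI := locallyCompactSpace_cmBorelU L 3 v; Representation.smoothIndRep _ _ x f₁) =
      (if h : IsUnit (((x.val : GL (Fin 3) (LocalRing L v)) : Matrix (Fin 3) (Fin 3) (LocalRing L v)) 0 0) then ((χ₁ h.unit : ℂˣ) : ℂ) else 0) • f₁)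
    (heig_w : ∀ x ∈ Je, (haveI := locallyCompactSpace_cmBorelU L 3 v; Representation.smoothIndRep _ _ x f_w) =
      (if h : IsUnit (((x.val : GL (Fin 3) (LocalRing L v)) : Matrix (Fin 3) (Fin 3) (LocalRing L v)) 0 0) then ((χ₁ h.unit : ℂˣ) : ℂ) else 0) • f_w)
    (h11 : f₁.toFun 1 = 1) (h1g : f₁.toFun w₀ = 0) (hw1 : f_w.toFun 1 = 0) (hwg : f_w.toFun w₀ = 1)
    (hi₁₁ : Integrable (fun n : ↥(cmBorelTriple L 3 v).N => f₁.toFun (w₀ * (n : ↥(unitaryGroupOfForm (conjLocal L (IsCMField.complexConj L) v) (cmLocalForm L 3 v))) * 1)) μ)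
    (hiw₁ : Integrable (fun n : ↥(cmBorelTriple L 3 v).N => f_w.toFun (w₀ * (n : ↥(unitaryGroupOfForm (conjLocal L (IsCMField.complexConj L) v) (cmLocalForm L 3 v))) * 1)) μ)
    (hi₁₂ : Integrable (fun n : ↥(cmBorelTriple L 3 v).N => f₁.toFun (w₀ * (n : ↥(unitaryGroupOfForm (conjLocal L (IsCMField.complexConj L) v) (cmLocalForm L 3 v))) * w₀)) μ)
    (hiw₂ : Integrable (fun n : ↥(cmBorelTriple L 3 v).N => f_w.toFun (w₀ * (n : ↥(unitaryGroupOfForm (conjLocal L (IsCMField.complexConj L) v) (cmLocalForm L 3 v))) * w₀)) μ)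
    (R : Set ↥(unitaryGroupOfForm (conjLocal L (IsCMField.complexConj L) v) (cmLocalForm L 3 v)))
    (hwit : ∀ r ∈ R, ∃ b₀ ∈ Je, ∃ hb₀H : r * b₀ * r⁻¹ ∈ (cmBorelTriple L 3 v).P,
      (if h : IsUnit (((b₀.val : GL (Fin 3) (LocalRing L v)) : Matrix (Fin 3) (Fin 3) (LocalRing L v)) 0 0) then ((χ₁ h.unit : ℂˣ) : ℂ) else 0) ≠
        (haveI := locallyCompactSpace_cmBorelU L 3 v
         (Representation.twist (((Representation.trivial ℂ ↥(torusU (conjLocal L (IsCMField.complexConj L) v) (cmLocalForm L 3 v)) ℂ).twist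
          (cmTorusCharPair L v χ₁ 1)).comp (cmBorelTriple L 3 v).proj) (rootDeltaChar (cmBorelTriple L 3 v).P)) ⟨r * b₀ * r⁻¹, hb₀H⟩ 1))
    (hcells : ∀ y : ↥(unitaryGroupOfForm (conjLocal L (IsCMField.complexConj L) v) (cmLocalForm L 3 v)), (∃ h ∈ (cmBorelTriple L 3 v).P, ∃ b ∈ Je, y = h * b) ∨ (∃ h ∈ (cmBorelTriple L 3 v).P, ∃ b ∈ Je, y = h * w₀ * b) ∨
      ∃ r ∈ R, ∃ h ∈ (cmBorelTriple L 3 v).P, ∃ b ∈ Je, y = h * r * b)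
    (hT : ∃ f : (haveI := locallyCompactSpace_cmBorelU L 3 v
        Representation.SmoothInd (cmBorelTriple L 3 v).P
          (Representation.twist (((Representation.trivial ℂ ↥(torusU (conjLocal L (IsCMField.complexConj L) v) (cmLocalForm L 3 v)) ℂ).twist
            (cmTorusCharPair L v χ₁ 1)).comp (cmBorelTriple L 3 v).proj) (rootDeltaChar (cmBorelTriple L 3 v).P))),
      (∀ x ∈ Je, (haveI := locallyCompactSpace_cmBorelU L 3 v; Representation.smoothIndRep _ _ x f) =
        (if h : IsUnit (((x.val : GL (Fin 3) (LocalRing L v)) : Matrix (Fin 3) (Fin 3) (LocalRing L v)) 0 0) then ((χ₁ h.unit : ℂˣ) : ℂ) else 0) • f) ∧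
      f.toFun 1 ≠ 0 ∧
      ∫ n : ↥(cmBorelTriple L 3 v).N, f.toFun (w₀ * (n : ↥(unitaryGroupOfForm (conjLocal L (IsCMField.complexConj L) v) (cmLocalForm L 3 v))) * 1) ∂μ = 0 ∧
      ∫ n : ↥(cmBorelTriple L 3 v).N, f.toFun (w₀ * (n : ↥(unitaryGroupOfForm (conjLocal L (IsCMField.complexConj L) v) (cmLocalForm L 3 v))) * w₀) ∂μ = 0)
    (V₁ V₂ : ℂ) (hV₁ : V₁ ≠ 0) (hV₂ : V₂ ≠ 0) (e₁ e₂ : ℕ) (Γ₁ Γ₂ : ℂ)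
    (hw1v : ∫ n : ↥(cmBorelTriple L 3 v).N, f_w.toFun (w₀ * (n : ↥(unitaryGroupOfForm (conjLocal L (IsCMField.complexConj L) v) (cmLocalForm L 3 v))) * 1) ∂μ =
      (((Ideal.absNorm w.1.asIdeal : ℝ) : ℂ) ^ e₂)⁻¹ * V₂)
    (h1wv : ∫ n : ↥(cmBorelTriple L 3 v).N, f₁.toFun (w₀ * (n : ↥(unitaryGroupOfForm (conjLocal L (IsCMField.complexConj L) v) (cmLocalForm L 3 v))) * w₀) ∂μ =
      (((Ideal.absNorm w.1.asIdeal : ℝ) : ℂ) ^ e₁)⁻¹ * V₁)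
    (hΓ : Γ₁ * Γ₂ * ((χ₁ (Units.map (conjLocal L (IsCMField.complexConj L) v : LocalRing L v →* LocalRing L v) piU * piU) : ℂˣ) : ℂ) =
      (((Ideal.absNorm w.1.asIdeal : ℝ) : ℂ) - 1) ^ 2 * ((((Ideal.absNorm w.1.asIdeal : ℝ) : ℂ)) ^ (e₁ + e₂ + 1))⁻¹)
    (h11v : ∫ n : ↥(cmBorelTriple L 3 v).N, f₁.toFun (w₀ * (n : ↥(unitaryGroupOfForm (conjLocal L (IsCMField.complexConj L) v) (cmLocalForm L 3 v))) * 1) ∂μ =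
      V₁ * (Γ₁ * ((χ₁ (Units.map (conjLocal L (IsCMField.complexConj L) v : LocalRing L v →* LocalRing L v) piU * piU) : ℂˣ) : ℂ) /
        (1 - ((χ₁ (Units.map (conjLocal L (IsCMField.complexConj L) v : LocalRing L v →* LocalRing L v) piU * piU) : ℂˣ) : ℂ))))
    (hwwv : ∫ n : ↥(cmBorelTriple L 3 v).N, f_w.toFun (w₀ * (n : ↥(unitaryGroupOfForm (conjLocal L (IsCMField.complexConj L) v) (cmLocalForm L 3 v))) * w₀) ∂μ =
      V₂ * (Γ₂ * ((χ₁ (Units.map (conjLocal L (IsCMField.complexConj L) v : LocalRing L v →* LocalRing L v) piU * piU) : ℂˣ) : ℂ) /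
        (1 - ((χ₁ (Units.map (conjLocal L (IsCMField.complexConj L) v : LocalRing L v →* LocalRing L v) piU * piU) : ℂˣ) : ℂ)))) :
    ∃ η : (LocalRing L v)ˣ →* ℂˣ, IsQuadraticCharExtension (conjLocal L (IsCMField.complexConj L) v) η ∧
      Continuous (fun x => ((η x : ℂˣ) : ℂ)) ∧ χ₁ = η * halfModulusChar (LocalRing L v) := by
  have hdet := det_eq_zero_of_typeLetters L v χ₁ Je w₀ μ f₁ f_w heig₁ heig_w h11 h1g hw1 hwg hi₁₁ hiw₁ hi₁₂ hiw₂ R hwit hcells hT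
  have hX := norm_apply_norm_uniformizer_lt_one L v hns w hw piU hpiU χ₁ hcontr
  exact WildDeterminantClosedForm.exists_eta_of_det_eq_zero_of_pairEntries_wild L v hns w hw piU hpiU χ₁ h₁ hB hFε e₁ e₂ Γ₁ Γ₂ V₁ V₂ _ _ _ _ hV₁ hV₂ hX
    h11v hwwv h1wv hw1v hΓ hdet

end Root

end Summit.HodgeConjecture.HodgeConjecture.R90.S1.WildPairEntriesEndAssembly

end
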